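import Mathlib.LinearAlgebra.SymplecticGroup
import Mathlib.Data.Matrix.Basis
import HarnessLib

/-!
# Goresky–Tai 2017, Proposition 44 (first assertion): a linear map normalising `Sp_{2n}` lies in `GSp_{2n}` —
# `ᵗτJτ = cJ` —, and an involution has multiplier `±1`

Goresky–Tai, *Real structures on ordinary abelian varieties*, arXiv:1701.07742, Appendix §19.1 p0043 (verbatim):

> «**Proposition 44.** ([Hua, Dieudonné, Huppert]) Let `R` be an integral domain that contains `½`.  Let
> `τ : R^{2n} → R^{2n}` be an `R`-linear mapping such that `τ² = I`, and suppose that conjugation by `τ` preserves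
> `Sp_{2n}(R) ⊂ GL_{2n}(R)`.  Then `τ ∈ GSp_{2n}(R)` and its multiplier is `±1`. …
> Proof. First we claim that `τ ∈ GSp_{2n}(R)`.  The matrix `M = ᵗτJτ` is antisymmetric and (strongly)
> nondegenerate so it defines a symplectic form and we claim that `Sp(R^{2n}, M) = Sp(R^{2n}, 𝔅₀)` for
> `g ∈ Sp_{2n}(M) ⟺ ᵗg ᵗτJτ g = ᵗτJτ ⟺ τgτ⁻¹ ∈ Sp_{2n}(𝔅₀) ⟺ g ∈ Sp_{2n}(𝔅₀)` since conjugation by `τ`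
> preserves `Sp_{2n}(𝔅₀)`.  Then `J⁻¹M : R^{2n} → R^{2n}` is an intertwining operator … By Schur's lemma there
> exists `c` (in the algebraic closure of the fraction field of `R`) such that `J⁻¹M = cI` or `ᵗτJτ = cJ`.  Thus
> `τ ∈ GSp_{2n}(𝔅₀)` has multiplier equal to `c`, and since `τ` is an involution we have `c = ±1`.»

## What is formalized (Mathlib conventions: `J = Matrix.J m R = (0 −1; 1 0)`, `Sp = Matrix.symplecticGroup m R`;
## «conjugation by `τ` preserves `Sp`» as `∀ g ∈ Sp, τgτ′ ∈ Sp` for an inverse `τ′`, `ττ′ = 1`)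

The FIRST assertion of Proposition 44 and the multiplier of an involution, over an ARBITRARY commutative ring
(no `½`, no integral domain needed for `ᵗτJτ = cJ`; no zero divisors for `c = ±1`), by a shorter road than the
printed Schur's lemma (a documented deviation): the symmetric-unipotent elements `(1 S; 0 1)`, `(1 0; S 1)` of
`Sp_{2n}(R)` already force an antisymmetric `M` with `ᵗgMg = M` to be a multiple of `J`.

* §1 the test elements: `upperUnipotent_mem_symplecticGroup`, `lowerUnipotent_mem_symplecticGroup` (`S` symmetric);
  `exists_eq_smul_one_of_forall_symm_comm` (a matrix commuting with every symmetric matrix is scalar — via the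
  symmetric test matrices `E_{aa}`, `E_{ab} + E_{ba}`).
* §2 ★ `exists_eq_smul_J_of_forall_unipotent` — «we claim that `Sp(R^{2n}, M) = Sp(R^{2n}, 𝔅₀)` … `ᵗτJτ = cJ`»: an
  antisymmetric `M` invariant under the symmetric unipotents of both shapes is `cJ`.
* §3 ★★ `exists_transpose_mul_J_mul_eq_smul_J` — **Proposition 44, first assertion** («`τ ∈ GSp_{2n}(R)`»): if
  `ττ′ = 1` and `τ·Sp·τ′ ⊆ Sp` then `ᵗτJτ = cJ` for some `c ∈ R`; ★★ `exists_mul_self_eq_one_and_transpose_mul_J_mul_eq_smul_J`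
  («since `τ` is an involution we have `c = ±1`»: for `τ² = 1` one may take `c` with `c² = 1`), and
  ★★ `transpose_mul_J_mul_eq_J_or_eq_neg_J_of_involution` (no zero divisors: `ᵗτJτ = J` or `ᵗτJτ = −J` — multiplier `±1`);
  the converse `conj_mem_symplecticGroup_of_transpose_mul_J_mul_eq_smul_J` (an element of `GSp` with invertible
  multiplier normalises `Sp`).

THEOREMS ONLY; no definition, instance, notation or named fact.  The rest of Proposition 44 is in the tree:
multiplier `+1` ⟹ conjugate to `diag(ε) ⊕ diag(ε)` (`SymplecticInvolutionDiagonalForm`), multiplier `−1` ⟹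
conjugate to `τ₀` (`SymplecticAntiInvolutionConjugacy`).

## References

* [GoreskyTai2017RealStructuresOrdinary] M. Goresky, Y.-S. Tai, *Real structures on ordinary abelian varieties*,
  arXiv:1701.07742 (2017), Appendix §19.1 Proposition 44 (first assertion) and its proof.
-/

noncomputable section

open Matrix

namespace Literature.LinearAlgebra.Matrix

namespace SymplecticNormalizer

variable {R : Type*} [CommRing R] {m : Type*} [Fintype m] [DecidableEq m]

/-! ## §1 Test elements of `Sp_{2n}(R)` and a commutation lemma -/

/-- `(1 S; 0 1) ∈ Sp_{2n}(R)` for `S` symmetric. [cite: GoreskyTai2017RealStructuresOrdinary, App. §19.2 proof of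
Lemma 45 («any element `(I T; 0 I) ∈ Sp_{2n}(ℤ)` (where `T` is symmetric)»)] -/
theorem upperUnipotent_mem_symplecticGroup {S : Matrix m m R} (hS : Sᵀ = S) :
    fromBlocks (1 : Matrix m m R) S 0 (1 : Matrix m m R) ∈ Matrix.symplecticGroup m R := by
  rw [SymplecticGroup.fromBlocks_mem_iff]
  simp [hS]

/-- `(1 0; S 1) ∈ Sp_{2n}(R)` for `S` symmetric. [cite: GoreskyTai2017RealStructuresOrdinary, App. §19.2 proof of
Lemma 45 («acting by `(I 0; S I)`»)] -/
theorem lowerUnipotent_mem_symplecticGroup {S : Matrix m m R} (hS : Sᵀ = S) :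
    fromBlocks (1 : Matrix m m R) 0 S (1 : Matrix m m R) ∈ Matrix.symplecticGroup m R := by
  rw [SymplecticGroup.fromBlocks_mem_iff]
  simp [hS]

/-- A square matrix commuting with every SYMMETRIC matrix is scalar (test matrices `E_{aa}` and `E_{ab} + E_{ba}`).
[folklore] -/
private theorem exists_eq_smul_one_of_forall_symm_comm (B : Matrix m m R)
    (h : ∀ S : Matrix m m R, Sᵀ = S → S * B = B * S) : ∃ c : R, B = c • (1 : Matrix m m R) := by
  cases isEmpty_or_nonempty m
  · exact ⟨0, Subsingleton.elim _ _⟩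
  obtain ⟨i₀⟩ := ‹Nonempty m›
  -- off-diagonal entries vanish (`S = E_{aa}`)
  have hoff : ∀ a b, a ≠ b → B a b = 0 := fun a b hab => by
    have hS : (single a a (1 : R))ᵀ = single a a 1 := transpose_single a a 1
    have e := congr_fun (congr_fun (h _ hS) a) b
    rw [single_mul_apply_same, one_mul, mul_single_apply_of_ne (hbj := Ne.symm hab)] at e
    exact e
  -- diagonal entries agree (`S = E_{ab} + E_{ba}`)
  have hdiag : ∀ a b, B a a = B b b := fun a b => by
    by_cases hab : a = b
    · rw [hab]
    have hS : (single a b (1 : R) + single b a 1)ᵀ = single a b 1 + single b a 1 := by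
      rw [transpose_add, transpose_single, transpose_single, add_comm]
    have e := congr_fun (congr_fun (h _ hS) a) b
    rw [Matrix.add_mul, Matrix.mul_add, Matrix.add_apply, Matrix.add_apply, single_mul_apply_same, one_mul,
      single_mul_apply_of_ne (h := hab), add_zero, mul_single_apply_same, mul_one,
      mul_single_apply_of_ne (hbj := Ne.symm hab), add_zero] at e
    exact e.symm
  refine ⟨B i₀ i₀, Matrix.ext fun a b => ?_⟩
  rw [Matrix.smul_apply, Matrix.one_apply, smul_eq_mul, mul_ite, mul_one, mul_zero]
  by_cases hab : a = b
  · subst hab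
    rw [if_pos rfl, hdiag a i₀]
  · rw [if_neg hab, hoff a b hab]

/-! ## §2 An antisymmetric matrix invariant under the symmetric unipotents is a multiple of `J` -/

/-- ★ **«We claim that `Sp(R^{2n}, M) = Sp(R^{2n}, 𝔅₀)` … hence `ᵗτJτ = cJ`» — the linear algebra**: if
`ᵗM = −M` and `ᵗgMg = M` for the symplectic unipotents `g = (1 S; 0 1)`, `(1 0; S 1)` (`S` symmetric), then
`M = cJ` for some `c ∈ R` (over any commutative ring; the print invokes Schur's lemma for the full group).
Writing `M = (A B; C D)`: the conditions give `AS = 0`, `SD = 0` (so `A = D = 0` with `S = 1`) and `SB = ᵗBS`,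
whence `B` is symmetric and commutes with all symmetric `S`, i.e. `B = c·1`, `M = (0 c; −c 0) = (−c)J`.
[cite: GoreskyTai2017RealStructuresOrdinary, App. §19.1 proof of Proposition 44] -/
theorem exists_eq_smul_J_of_forall_unipotent (M : Matrix (m ⊕ m) (m ⊕ m) R) (hM : Mᵀ = -M)
    (h₁ : ∀ S : Matrix m m R, Sᵀ = S →
      (fromBlocks (1 : Matrix m m R) S 0 (1 : Matrix m m R))ᵀ * M * fromBlocks (1 : Matrix m m R) S 0 (1 : Matrix m m R) = M)
    (h₂ : ∀ S : Matrix m m R, Sᵀ = S →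
      (fromBlocks (1 : Matrix m m R) 0 S (1 : Matrix m m R))ᵀ * M * fromBlocks (1 : Matrix m m R) 0 S (1 : Matrix m m R) = M) :
    ∃ c : R, M = c • Matrix.J m R := by
  -- blocks `M = (A B; C D)`
  set A := M.toBlocks₁₁ with hA
  set B := M.toBlocks₁₂ with hB
  set C := M.toBlocks₂₁ with hC
  set D := M.toBlocks₂₂ with hD
  have hMb : M = fromBlocks A B C D := (fromBlocks_toBlocks M).symm
  -- antisymmetry: `ᵗB = −C`
  have hT := hM
  rw [hMb, fromBlocks_transpose, fromBlocks_neg, fromBlocks_inj] at hT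
  obtain ⟨-, -, hBt, -⟩ := hT
  -- the two unipotent conditions, in blocks
  have blocks₁ : ∀ S : Matrix m m R, Sᵀ = S → A * S + B = B ∧ (S * A + C) * S + (S * B + D) = D := fun S hS => by
    have e := h₁ S hS
    rw [hMb, fromBlocks_transpose, transpose_one, transpose_zero, hS, fromBlocks_multiply, fromBlocks_multiply,
      fromBlocks_inj] at e
    obtain ⟨-, e12, -, e22⟩ := e
    simp only [Matrix.one_mul, Matrix.zero_mul, add_zero, Matrix.mul_one] at e12 e22
    exact ⟨e12, e22⟩
  have blocks₂ : ∀ S : Matrix m m R, Sᵀ = S → B + S * D = B := fun S hS => by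
    have e := h₂ S hS
    rw [hMb, fromBlocks_transpose, transpose_one, transpose_zero, hS, fromBlocks_multiply, fromBlocks_multiply,
      fromBlocks_inj] at e
    obtain ⟨-, e12, -, -⟩ := e
    simp only [Matrix.one_mul, Matrix.mul_one, Matrix.mul_zero, zero_add] at e12
    exact e12
  have hA0 : A = 0 := by simpa using (blocks₁ 1 transpose_one).1
  have hD0 : D = 0 := by simpa using blocks₂ 1 transpose_one
  -- `C S + S B = 0`, i.e. `SB = ᵗBS`, for all symmetric `S`
  have hSB : ∀ S : Matrix m m R, Sᵀ = S → S * B = Bᵀ * S := fun S hS => by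
    have e := (blocks₁ S hS).2
    rw [hA0, hD0, Matrix.mul_zero, zero_add, add_zero] at e
    -- e : C * S + S * B = 0, and `ᵗB S = −C S`
    rw [hBt, Matrix.neg_mul, eq_neg_iff_add_eq_zero, add_comm]
    exact e
  have hBsymm : Bᵀ = B := by
    have := hSB 1 transpose_one
    rw [Matrix.one_mul, Matrix.mul_one] at this
    exact this.symm
  obtain ⟨c, hc⟩ := exists_eq_smul_one_of_forall_symm_comm B fun S hS => by rw [hSB S hS, hBsymm]
  refine ⟨-c, ?_⟩
  have hCc : C = -(c • (1 : Matrix m m R)) := by rw [← hc, ← hBsymm, hBt, neg_neg]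
  rw [hMb, hA0, hD0, hc, hCc, Matrix.J, fromBlocks_smul, smul_zero, smul_neg, neg_smul, neg_neg]

/-! ## §3 Proposition 44, first assertion: a linear map normalising `Sp_{2n}(R)` has a multiplier -/

/-- For `ττ′ = 1` and `g` with `τgτ′ ∈ Sp`: `ᵗgMg = M` for `M = ᵗτJτ` («`g ∈ Sp_{2n}(M) ⟺ ᵗg ᵗτJτ g = ᵗτJτ ⟺
τgτ⁻¹ ∈ Sp_{2n}(𝔅₀)`»). [cite: GoreskyTai2017RealStructuresOrdinary, App. §19.1 proof of Proposition 44] -/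
theorem transpose_mul_mul_eq_of_conj_mem {τ τ' g : Matrix (m ⊕ m) (m ⊕ m) R} (hττ' : τ * τ' = 1)
    (hg : τ * g * τ' ∈ Matrix.symplecticGroup m R) :
    gᵀ * (τᵀ * Matrix.J m R * τ) * g = τᵀ * Matrix.J m R * τ := by
  have hτ'τ : τ' * τ = 1 := mul_eq_one_comm.1 hττ'
  rw [SymplecticGroup.mem_iff', transpose_mul, transpose_mul] at hg
  -- hg : τ'ᵀ * (gᵀ * τᵀ) * J * (τ * g * τ') = J ; conjugate back by `ᵗτ … τ`
  have e := congrArg (fun X => τᵀ * X * τ) hg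
  calc gᵀ * (τᵀ * Matrix.J m R * τ) * g
      = (τ' * τ)ᵀ * (gᵀ * (τᵀ * Matrix.J m R * τ) * g) * (τ' * τ) := by rw [hτ'τ, transpose_one, Matrix.one_mul, Matrix.mul_one]
    _ = τᵀ * (τ'ᵀ * (gᵀ * τᵀ) * Matrix.J m R * (τ * g * τ')) * τ := by
        rw [transpose_mul]; simp only [Matrix.mul_assoc]
    _ = τᵀ * Matrix.J m R * τ := e

/-- ★★ **Goresky–Tai 2017, Proposition 44, first assertion («`τ ∈ GSp_{2n}(R)`»), over any commutative ring**: if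
`τ` is invertible (`ττ′ = 1`) and conjugation by `τ` preserves `Sp_{2n}(R)` (`g ∈ Sp ⟹ τgτ′ ∈ Sp`), then
`ᵗτJτ = cJ` for some `c ∈ R` (the multiplier).  Proof by the symmetric unipotents of `Sp_{2n}(R)` (§2) instead of
Schur's lemma. [cite: GoreskyTai2017RealStructuresOrdinary, App. §19.1 Proposition 44 (first assertion) and proof] -/
theorem exists_transpose_mul_J_mul_eq_smul_J {τ τ' : Matrix (m ⊕ m) (m ⊕ m) R} (hττ' : τ * τ' = 1)
    (hpres : ∀ g ∈ Matrix.symplecticGroup m R, τ * g * τ' ∈ Matrix.symplecticGroup m R) :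
    ∃ c : R, τᵀ * Matrix.J m R * τ = c • Matrix.J m R := by
  refine exists_eq_smul_J_of_forall_unipotent _ ?_ (fun S hS => ?_) (fun S hS => ?_)
  · rw [transpose_mul, transpose_mul, transpose_transpose, Matrix.J_transpose, Matrix.neg_mul, Matrix.mul_neg,
      Matrix.mul_assoc]
  · exact transpose_mul_mul_eq_of_conj_mem hττ' (hpres _ (upperUnipotent_mem_symplecticGroup hS))
  · exact transpose_mul_mul_eq_of_conj_mem hττ' (hpres _ (lowerUnipotent_mem_symplecticGroup hS))

/-- ★★ **«since `τ` is an involution we have `c = ±1`» — over any commutative ring, `c² = 1`**: if `τ² = 1` and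
conjugation by `τ` preserves `Sp_{2n}(R)`, then `ᵗτJτ = cJ` for some `c` with `c·c = 1`.
[cite: GoreskyTai2017RealStructuresOrdinary, App. §19.1 Proposition 44 (first assertion) and proof] -/
theorem exists_mul_self_eq_one_and_transpose_mul_J_mul_eq_smul_J {τ : Matrix (m ⊕ m) (m ⊕ m) R} (hττ : τ * τ = 1)
    (hpres : ∀ g ∈ Matrix.symplecticGroup m R, τ * g * τ ∈ Matrix.symplecticGroup m R) :
    ∃ c : R, c * c = 1 ∧ τᵀ * Matrix.J m R * τ = c • Matrix.J m R := by
  cases isEmpty_or_nonempty m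
  · exact ⟨1, one_mul 1, Subsingleton.elim _ _⟩
  obtain ⟨i⟩ := ‹Nonempty m›
  obtain ⟨c, hc⟩ := exists_transpose_mul_J_mul_eq_smul_J hττ hpres
  refine ⟨c, ?_, hc⟩
  -- `J = ᵗ(ττ)J(ττ) = ᵗτ(cJ)τ = c²J`; read off the `(inr i, inl i)` entry (`= 1` for `J`)
  have e : Matrix.J m R = (c * c) • Matrix.J m R := by
    calc Matrix.J m R = (τ * τ)ᵀ * Matrix.J m R * (τ * τ) := by rw [hττ, transpose_one, Matrix.one_mul, Matrix.mul_one]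
      _ = τᵀ * (τᵀ * Matrix.J m R * τ) * τ := by rw [transpose_mul]; simp only [Matrix.mul_assoc]
      _ = (c * c) • Matrix.J m R := by rw [hc, Matrix.mul_smul, Matrix.smul_mul, hc, smul_smul]
  have e' := congr_fun (congr_fun e (Sum.inr i)) (Sum.inl i)
  rw [Matrix.smul_apply, Matrix.J, fromBlocks_apply₂₁, Matrix.one_apply_eq, smul_eq_mul, mul_one] at e'
  exact e'.symm

/-- ★★ **Proposition 44, first assertion, as printed for integral domains (any commutative ring without zero
divisors): an involution `τ` normalising `Sp_{2n}(R)` has multiplier `±1`** — `ᵗτJτ = J` or `ᵗτJτ = −J`.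
[cite: GoreskyTai2017RealStructuresOrdinary, App. §19.1 Proposition 44 («Then `τ ∈ GSp_{2n}(R)` and its multiplier
is `±1`»)] -/
theorem transpose_mul_J_mul_eq_J_or_eq_neg_J_of_involution [NoZeroDivisors R] {τ : Matrix (m ⊕ m) (m ⊕ m) R}
    (hττ : τ * τ = 1) (hpres : ∀ g ∈ Matrix.symplecticGroup m R, τ * g * τ ∈ Matrix.symplecticGroup m R) :
    τᵀ * Matrix.J m R * τ = Matrix.J m R ∨ τᵀ * Matrix.J m R * τ = -Matrix.J m R := by
  obtain ⟨c, hcc, hc⟩ := exists_mul_self_eq_one_and_transpose_mul_J_mul_eq_smul_J hττ hpres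
  rcases mul_self_eq_one_iff.1 hcc with rfl | rfl
  · left; rw [hc, one_smul]
  · right; rw [hc, neg_smul, one_smul]

/-- **The converse: an element of `GSp_{2n}(R)` with invertible multiplier normalises `Sp_{2n}(R)`** — if
`ᵗτJτ = cJ`, `cc′ = 1`, `ττ′ = 1`, then `g ∈ Sp ⟹ τgτ′ ∈ Sp`.
[cite: GoreskyTai2017RealStructuresOrdinary, App. §19.1 proof of Proposition 44 («`Sp(R^{2n}, M) = Sp(R^{2n}, 𝔅₀)`»)] -/
theorem conj_mem_symplecticGroup_of_transpose_mul_J_mul_eq_smul_J {τ τ' : Matrix (m ⊕ m) (m ⊕ m) R} {c c' : R}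
    (hττ' : τ * τ' = 1) (hc : τᵀ * Matrix.J m R * τ = c • Matrix.J m R) (hcc' : c * c' = 1)
    {g : Matrix (m ⊕ m) (m ⊕ m) R} (hg : g ∈ Matrix.symplecticGroup m R) :
    τ * g * τ' ∈ Matrix.symplecticGroup m R := by
  rw [SymplecticGroup.mem_iff'] at hg ⊢
  have hτ'τ : τ' * τ = 1 := mul_eq_one_comm.1 hττ'
  -- `ᵗτ′Jτ′ = c′J`
  have hc' : τ'ᵀ * Matrix.J m R * τ' = c' • Matrix.J m R := by
    calc τ'ᵀ * Matrix.J m R * τ' = τ'ᵀ * ((c' * c) • Matrix.J m R) * τ' := by rw [mul_comm c' c, hcc', one_smul]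
      _ = c' • (τ'ᵀ * (τᵀ * Matrix.J m R * τ) * τ') := by
          rw [hc]; simp only [Matrix.mul_smul, Matrix.smul_mul, smul_smul]
      _ = c' • ((τ * τ')ᵀ * Matrix.J m R * (τ * τ')) := by rw [transpose_mul]; simp only [Matrix.mul_assoc]
      _ = c' • Matrix.J m R := by rw [hττ', transpose_one, Matrix.one_mul, Matrix.mul_one]
  calc (τ * g * τ')ᵀ * Matrix.J m R * (τ * g * τ')
      = τ'ᵀ * (gᵀ * (τᵀ * Matrix.J m R * τ) * g) * τ' := by
        rw [transpose_mul, transpose_mul]; simp only [Matrix.mul_assoc]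
    _ = c • (τ'ᵀ * (gᵀ * Matrix.J m R * g) * τ') := by
        rw [hc]; simp only [Matrix.mul_smul, Matrix.smul_mul]
    _ = Matrix.J m R := by rw [hg, hc', smul_smul, hcc', one_smul]

end SymplecticNormalizer

end Literature.LinearAlgebra.Matrix
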